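import Summits.BirchSwinnertonDyer.BirchSwinnertonDyer.Theorems.OneSidedTwistSqueezeX9KatoDivisibilityX9CentralScalarPk
import Literature.NumberTheory.EllipticCurves.IwasawaTwistModPk
import HarnessLib

set_option autoImplicit false

-- the summit and its single problem are both named `BirchSwinnertonDyer` (registry layout D-0017)
set_option linter.dupNamespace false

/-!
# Sah's lemma on the level-`p^k` twists `𝒯_J^{(k)}(E) = W.modPkTwist p k κ J` (T-es-6 (a), p618074): two continuous
# 1-cocycles of `Γ` agreeing on `ker ρ_{E,p^k} ⊓ ker κ` have the same class — the (F8) bridge at level `p^k`, service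
# lemma for `stub_kolyvaginPrimePkX9` / `stub_reciprocityPkX9` of line `graded_euler_loss`

Seat `bsd-line-k6-p4` (prover-bsd-line-k6-p4-g4-0, 4th LEAD on crux stmt-BirchSwinnertonDyer-20547, skeleton v3).  THEOREMS ONLY,
sorry-free, no definition, nothing asserted about any curve beyond what the kernel proves.  `--supports stmt-BirchSwinnertonDyer-20547`.
Port of `…X9CentralScalar` §2–§3 / `…X9CentralScalarOdd` §1–§2 (MU-TRANSFER-PROOF (F8), Sah relative to `G_{L₀}`) from
`𝒯_J(E) = E[p] ⊗ 𝔽_p[T]/T^J` to `𝒯_J^{(k)}(E) = E[p^k] ⊗ (ℤ/p^k)[T]/T^J`: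

* §1 (any field `F`, any `κ`): `ker κ` acts on `𝒯_J^{(k)}(E)` through `E[p^k]` alone (`modPkTwist_apply_of_mem_kerSubgroup`);
  an element `σ₁ ∈ ker κ` acting on `E[p^k]` as an integer scalar `c` acts on every `𝒯_J^{(k)}(E)` as `c`
  (`modPkTwist_eq_zsmul_of_mem_kerSubgroup`), is central modulo `ker ρ_{E,p^k} ⊓ ker κ`
  (`exists_mem_inf_mul_eq_of_zsmul_eq_pk`), and `x ↦ c•x − x` is bijective when `p ∤ c − 1`
  (`bijective_zsmul_sub_self_pk`, Bézout — no module structure over `ℤ/p^k` needed); hence the FIELD-AGNOSTIC Sah bridge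
  `modPkTwist_oneCocycleClass_eq_of_forall_mem_eq_of_zsmul_eq` (+ vanishing and `invTwist` forms).
* §2 (`E/ℚ`, `p ≠ 2`, `E[p]` irreducible, `ρ̄` not surjective): with the level-`p^k` central scalar of
  `…CentralScalarPk.exists_mem_kerSubgroup_smul_eq_pk_of_ne_two`, two continuous 1-cocycles of `Γ_ℚ` in
  `W.modPkTwist p k κ J` (resp. the `κ⁻¹`-twist) agreeing on `ker ρ_{E,p^k} ⊓ ker κ` have the same class
  (`modPkTwist_oneCocycleClass_eq_of_forall_mem_eq_of_ne_two`, `…eq_zero…`, `invTwist_…`).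

References: C.-H. Sah, J. Algebra 10 (1968) Prop. 2.7 (b) [Sah1968]; J.-P. Serre, Invent. Math. 15 (1972) §2.4 Prop. 15, §2.6
[Serre1972]; L. C. Washington, GTM 83, §13.1 [Washington1997]; HOME/MEMO-es.md §15 STEP 1–2, §25.7.
-/

noncomputable section

open scoped ContRepresentation
open Field WeierstrassCurve Literature.NumberTheory.EllipticCurves Literature.NumberTheory.GaloisRepresentations Function
open Summit.BirchSwinnertonDyer.BirchSwinnertonDyer.Rank1Residual
open Summit.BirchSwinnertonDyer.BirchSwinnertonDyer.Theorems.OneSidedTwistSqueezeX9KatoDivisibilityX9CentralScalarPk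

namespace Summit.BirchSwinnertonDyer.BirchSwinnertonDyer.Theorems.OneSidedTwistSqueezeX9KatoDivisibilityX9SahPk

/-! ## §1 Any field: `ker κ` on `𝒯_J^{(k)}(E)`, the scalar, centrality, bijectivity, the Sah bridge -/

section AnyField

universe u

variable {F : Type u} [Field F] (W : WeierstrassCurve F) (p : ℕ) [Fact p.Prime] (k : ℕ)
  (κ : ZpExtension F p) (J : ℕ)

/-- **`ker κ = Gal(F̄/F_∞)` acts on `𝒯_J^{(k)}(E)` through `E[p^k]` alone, at every level `J`** (the twist character is
trivial on `ker κ`). [cite: Washington1997, §13.1–§13.2] -/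
theorem modPkTwist_apply_of_mem_kerSubgroup {σ : absoluteGaloisGroup F} (hσ : σ ∈ κ.kerSubgroup)
    (x : Fin J → geomTorsion W ((p : ℤ) ^ k)) : W.modPkTwist p k κ J σ x = fun i => σ • x i := by
  rw [WeierstrassCurve.modPkTwist_apply, twistExponent_eq_zero_of_mem_kerSubgroup p κ (J + k) hσ,
    unipotentPow_zero, Module.End.one_apply]

/-- **An element of `ker κ` acting on `E[p^k]` as the integer scalar `c` acts on every `𝒯_J^{(k)}(E)` as `c`** (for `κ` and,
same element, for any unit twist of `κ`, e.g. `κ⁻¹`). [cite: Washington1997, §13.1–§13.2] -/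
theorem modPkTwist_eq_zsmul_of_mem_kerSubgroup {σ₁ : absoluteGaloisGroup F} {c : ℤ}
    (hσ₁ : ∀ P : geomTorsion W ((p : ℤ) ^ k), σ₁ • P = c • P) (hκ : σ₁ ∈ κ.kerSubgroup)
    (x : Fin J → geomTorsion W ((p : ℤ) ^ k)) : W.modPkTwist p k κ J σ₁ x = c • x := by
  rw [modPkTwist_apply_of_mem_kerSubgroup W p k κ J hκ]
  funext i
  rw [hσ₁, Pi.smul_apply]

/-- **A scalar on `E[p^k]` inside `ker κ` is central in `Γ_F` modulo `ker ρ_{E,p^k} ⊓ ker κ`**: `σ₁ g = g σ₁ ν` with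
`ν = σ₁⁻¹g⁻¹σ₁g` acting trivially on `E[p^k]` and killed by `κ`. [cite: Serre1972, §2.6] [cite: Washington1997, §13.1] -/
theorem exists_mem_inf_mul_eq_of_zsmul_eq_pk {σ₁ : absoluteGaloisGroup F} {c : ℤ}
    (hσ₁ : ∀ P : geomTorsion W ((p : ℤ) ^ k), σ₁ • P = c • P) (hκ : σ₁ ∈ κ.kerSubgroup)
    (g : absoluteGaloisGroup F) :
    ∃ ν ∈ (galoisRepTorsion W ((p : ℤ) ^ k)).ker ⊓ κ.kerSubgroup, σ₁ * g = g * σ₁ * ν := by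
  refine ⟨σ₁⁻¹ * g⁻¹ * σ₁ * g, Subgroup.mem_inf.mpr ⟨?_, ?_⟩, by group⟩
  · rw [MonoidHom.mem_ker]
    apply Multiplicative.toAdd.injective
    refine AddEquiv.ext fun P => ?_
    have hg : ∀ Q : geomTorsion W ((p : ℤ) ^ k), g⁻¹ • (c • Q) = c • (g⁻¹ • Q) := fun Q =>
      (DistribSMul.toAddMonoidHom _ g⁻¹).map_zsmul c Q
    rw [galoisRepTorsion_apply, toAdd_one, AddAut.zero_apply, mul_smul, mul_smul, mul_smul, hσ₁, hg, inv_smul_smul,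
      ← hσ₁, inv_smul_smul]
  · rw [ZpExtension.mem_kerSubgroup] at hκ ⊢
    rw [map_mul, map_mul, map_mul, map_inv, map_inv, hκ, inv_one, one_mul, mul_one, inv_mul_cancel]

/-- **`x ↦ c•x − x` is BIJECTIVE on `𝒯_J^{(k)}(E)` when `p ∤ c − 1`** (Bézout: `u(c−1) + v p^k = 1` and `p^k` kills `E[p^k]`, so
`x ↦ u•x` is a two-sided inverse). [cite: Serre1972, §2.6] -/
theorem bijective_zsmul_sub_self_pk {c : ℤ} (hc : ¬ ((p : ℤ) ∣ (c - 1))) :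
    Bijective fun x : Fin J → geomTorsion W ((p : ℤ) ^ k) => c • x - x := by
  have hp : Prime (p : ℤ) := Nat.prime_iff_prime_int.mp (Fact.out : p.Prime)
  have hcop : IsCoprime (c - 1) ((p : ℤ) ^ k) :=
    ((Prime.coprime_iff_not_dvd hp).mpr hc).symm.pow_right
  obtain ⟨u, v, huv⟩ := hcop
  have hA : ∀ x : Fin J → geomTorsion W ((p : ℤ) ^ k), ((p : ℤ) ^ k) • x = 0 := fun x => by
    funext i
    apply Subtype.ext
    have hx := (x i).2
    simp only [Submodule.mem_toAddSubgroup, Submodule.mem_torsionBy_iff] at hx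
    rw [Pi.smul_apply, Pi.zero_apply, AddSubgroupClass.coe_zsmul, ZeroMemClass.coe_zero]
    exact hx
  have hfun : ∀ x : Fin J → geomTorsion W ((p : ℤ) ^ k), c • x - x = (c - 1) • x := fun x => by
    rw [sub_smul, one_smul]
  have hinv : ∀ x : Fin J → geomTorsion W ((p : ℤ) ^ k), u • ((c - 1) • x) = x := fun x => by
    have h1 : x = (u * (c - 1) + v * (p : ℤ) ^ k) • x := by rw [huv, one_smul]
    conv_rhs => rw [h1]
    rw [add_smul, mul_smul, mul_smul, hA, smul_zero, add_zero]
  refine ⟨fun x y hxy => ?_, fun y => ⟨u • y, ?_⟩⟩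
  · have h := congrArg (fun z => u • z) hxy
    simp only [hfun, hinv] at h
    exact h
  · change c • (u • y) - u • y = y
    rw [hfun, smul_comm, hinv]

/-- **Sah on `𝒯_J^{(k)}(E)`, field-agnostic core.**  GIVEN `σ₁ ∈ ker κ` acting on `E[p^k]` as an integer scalar `c` with
`p ∤ c − 1`, two continuous 1-cocycles of `Γ_F` in `W.modPkTwist p k κ J` that agree on `ker ρ_{E,p^k} ⊓ ker κ` have the
same class (relative Sah `SahRel.oneCocycleClass_eq_of_forall_mem_eq` with `z = σ₁`). [cite: Sah1968, Prop. 2.7 (b) and its proof, p. 60]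
[cite: Serre1972, §2.6] -/
theorem modPkTwist_oneCocycleClass_eq_of_forall_mem_eq_of_zsmul_eq {σ₁ : absoluteGaloisGroup F} {c : ℤ}
    (hc : ¬ ((p : ℤ) ∣ (c - 1))) (hκ : σ₁ ∈ κ.kerSubgroup)
    (hσ₁ : ∀ P : geomTorsion W ((p : ℤ) ^ k), σ₁ • P = c • P) (φ ψ : contOneCocycles (W.modPkTwist p k κ J).toTopRep)
    (hN : ∀ ν ∈ (galoisRepTorsion W ((p : ℤ) ^ k)).ker ⊓ κ.kerSubgroup, φ.1 ν = ψ.1 ν) :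
    oneCocycleClass _ φ = oneCocycleClass _ ψ := by
  have hρσ₁ : ∀ x : (W.modPkTwist p k κ J).toTopRep, (W.modPkTwist p k κ J).toTopRep.ρ σ₁ x = c • x :=
    fun x => modPkTwist_eq_zsmul_of_mem_kerSubgroup W p k κ J hσ₁ hκ x
  refine SahRel.oneCocycleClass_eq_of_forall_mem_eq φ ψ _ hN (exists_mem_inf_mul_eq_of_zsmul_eq_pk W p k κ hσ₁ hκ)
    (fun g x => ?_) ?_
  · rw [hρσ₁, hρσ₁, map_zsmul]
  · have : (fun x : (W.modPkTwist p k κ J).toTopRep => (W.modPkTwist p k κ J).toTopRep.ρ σ₁ x - x) =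
        fun x : Fin J → geomTorsion W ((p : ℤ) ^ k) => c • x - x := by
      funext x
      rw [hρσ₁]
    rw [this]
    exact bijective_zsmul_sub_self_pk W p k J hc

/-- Field-agnostic core, vanishing form. [cite: Sah1968, Prop. 2.7 (b) and its proof, p. 60] -/
theorem modPkTwist_oneCocycleClass_eq_zero_of_forall_mem_eq_zero_of_zsmul_eq {σ₁ : absoluteGaloisGroup F} {c : ℤ}
    (hc : ¬ ((p : ℤ) ∣ (c - 1))) (hκ : σ₁ ∈ κ.kerSubgroup)
    (hσ₁ : ∀ P : geomTorsion W ((p : ℤ) ^ k), σ₁ • P = c • P) (φ : contOneCocycles (W.modPkTwist p k κ J).toTopRep)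
    (hN : ∀ ν ∈ (galoisRepTorsion W ((p : ℤ) ^ k)).ker ⊓ κ.kerSubgroup, φ.1 ν = 0) :
    oneCocycleClass _ φ = 0 := by
  rw [← oneCocycleClass_zero (W.modPkTwist p k κ J).toTopRep]
  exact modPkTwist_oneCocycleClass_eq_of_forall_mem_eq_of_zsmul_eq W p k κ J hc hκ hσ₁ φ 0
    (fun ν hν => by rw [hN ν hν]; rfl)

/-- Field-agnostic core, dual side (`κ⁻¹ = κ.invTwist`, same subgroup, same `σ₁`). [cite: Sah1968, Prop. 2.7 (b) and its proof, p. 60] -/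
theorem invTwist_modPkTwist_oneCocycleClass_eq_of_forall_mem_eq_of_zsmul_eq {σ₁ : absoluteGaloisGroup F} {c : ℤ}
    (hc : ¬ ((p : ℤ) ∣ (c - 1))) (hκ : σ₁ ∈ κ.kerSubgroup)
    (hσ₁ : ∀ P : geomTorsion W ((p : ℤ) ^ k), σ₁ • P = c • P)
    (φ ψ : contOneCocycles (W.modPkTwist p k κ.invTwist J).toTopRep)
    (hN : ∀ ν ∈ (galoisRepTorsion W ((p : ℤ) ^ k)).ker ⊓ κ.kerSubgroup, φ.1 ν = ψ.1 ν) :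
    oneCocycleClass _ φ = oneCocycleClass _ ψ := by
  have hκ' : σ₁ ∈ κ.invTwist.kerSubgroup := by
    rw [ZpExtension.kerSubgroup_unitTwist]
    exact hκ
  refine modPkTwist_oneCocycleClass_eq_of_forall_mem_eq_of_zsmul_eq W p k κ.invTwist J hc hκ' hσ₁ φ ψ ?_
  rw [ZpExtension.kerSubgroup_unitTwist]
  exact hN

end AnyField

/-! ## §2 Over `ℚ` at every odd prime with `E[p]` irreducible and `ρ̄` not surjective -/

section RatOdd

variable (W : WeierstrassCurve ℚ) [W.IsElliptic] (p : ℕ) [Fact p.Prime] (k : ℕ) (κ : ZpExtension ℚ p) (J : ℕ)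

/-- **Sah on `𝒯_J^{(k)}(E)` over `ℚ` at an odd prime** (`p ≠ 2`, `E[p]` irreducible, `ρ̄_{E,p}` not surjective): two
continuous 1-cocycles of `Γ_ℚ` in `W.modPkTwist p k κ J` agreeing on `ker ρ_{E,p^k} ⊓ ker κ = Gal(ℚ̄/ℚ(E[p^k])·ℚ_∞)` have the
same class — §1 with the level-`p^k` central scalar of `…CentralScalarPk`. [cite: Sah1968, Prop. 2.7 (b) and its proof, p. 60]
[cite: Serre1972, §2.4 Prop. 15 and §2.6] -/
theorem modPkTwist_oneCocycleClass_eq_of_forall_mem_eq_of_ne_two (hp2 : p ≠ 2)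
    (hirr : W.HasIrreducibleModPGaloisRep p) (hns : ¬ W.HasSurjectiveModNGaloisRep p)
    (φ ψ : contOneCocycles (W.modPkTwist p k κ J).toTopRep)
    (hN : ∀ ν ∈ (galoisRepTorsion W ((p : ℤ) ^ k)).ker ⊓ κ.kerSubgroup, φ.1 ν = ψ.1 ν) :
    oneCocycleClass _ φ = oneCocycleClass _ ψ := by
  obtain ⟨σ₁, c, hc, hκ, hσ₁⟩ := exists_mem_kerSubgroup_smul_eq_pk_of_ne_two W p κ hp2 hirr hns k
  exact modPkTwist_oneCocycleClass_eq_of_forall_mem_eq_of_zsmul_eq W p k κ J hc hκ hσ₁ φ ψ hN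

/-- Vanishing form over `ℚ` at an odd prime. [cite: Sah1968, Prop. 2.7 (b) and its proof, p. 60] -/
theorem modPkTwist_oneCocycleClass_eq_zero_of_forall_mem_eq_zero_of_ne_two (hp2 : p ≠ 2)
    (hirr : W.HasIrreducibleModPGaloisRep p) (hns : ¬ W.HasSurjectiveModNGaloisRep p)
    (φ : contOneCocycles (W.modPkTwist p k κ J).toTopRep)
    (hN : ∀ ν ∈ (galoisRepTorsion W ((p : ℤ) ^ k)).ker ⊓ κ.kerSubgroup, φ.1 ν = 0) :
    oneCocycleClass _ φ = 0 := by
  obtain ⟨σ₁, c, hc, hκ, hσ₁⟩ := exists_mem_kerSubgroup_smul_eq_pk_of_ne_two W p κ hp2 hirr hns k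
  exact modPkTwist_oneCocycleClass_eq_zero_of_forall_mem_eq_zero_of_zsmul_eq W p k κ J hc hκ hσ₁ φ hN

/-- Dual side over `ℚ` at an odd prime (`κ⁻¹`-twist, same subgroup). [cite: Sah1968, Prop. 2.7 (b) and its proof, p. 60] -/
theorem invTwist_modPkTwist_oneCocycleClass_eq_of_forall_mem_eq_of_ne_two (hp2 : p ≠ 2)
    (hirr : W.HasIrreducibleModPGaloisRep p) (hns : ¬ W.HasSurjectiveModNGaloisRep p)
    (φ ψ : contOneCocycles (W.modPkTwist p k κ.invTwist J).toTopRep)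
    (hN : ∀ ν ∈ (galoisRepTorsion W ((p : ℤ) ^ k)).ker ⊓ κ.kerSubgroup, φ.1 ν = ψ.1 ν) :
    oneCocycleClass _ φ = oneCocycleClass _ ψ := by
  obtain ⟨σ₁, c, hc, hκ, hσ₁⟩ := exists_mem_kerSubgroup_smul_eq_pk_of_ne_two W p κ hp2 hirr hns k
  exact invTwist_modPkTwist_oneCocycleClass_eq_of_forall_mem_eq_of_zsmul_eq W p k κ J hc hκ hσ₁ φ ψ hN

end RatOdd

end Summit.BirchSwinnertonDyer.BirchSwinnertonDyer.Theorems.OneSidedTwistSqueezeX9KatoDivisibilityX9SahPk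

end
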